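import Mathlib
import Summits.PneNP.PneNP.Theorems.ConvexRankGatesConvexGateBlindCodimensionEventual

/-!
# PneNP / ConvexRankGates — `ConvexGateBlind`: ε-sensitivity costs `m^{1/2 − δ − o(1)}` terms (quantitative codimension theorem)

Helpers (`--supports stmt-PneNP-10680`), COLUMN-SPACE line (prover seat 2, session 23) — the quantitative form of
`…CodimensionEventual`: the codimension defect of the row objects of a polynomial-size non-negative factorisation of the LP
slice of the crux must exceed `m^{(1−2δ)/2 − η}` for every `η > 0` (`lpSlice_codim_gt_rpow`, registered
`lpSlice_codimension_rpow`), and consequently **`rk₊(D − εJ) > C(m,2) + p` whenever `p + 1 ≤ m^{(1−2δ)/2−η}`**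
(`lpSlice_terms_gt_choose_two_add_rpow`, registered `lpSlice_rank_plus_rpow`; factor-rank form `lpSlice_factorRank_gt_rpow`,
registered `lpSlice_factor_rank_plus_rpow`): for the explicit clique-distance matrix,
ε-sensitivity costs at least `m^{1/2 − δ − o(1)}` extra terms, for every `ε > 0`, eventually in `m` (`k = ⌈m^δ⌉₊`, all
`δ ∈ (0,1/2)`). The exponent is that of the third-generation catch bound `exp(−Ω(√m / k))` of the column-space theorem:
the restricted factorisation produced by the codimension argument has `≤ (R+1)^{p+1} = exp(O(p log m))` terms.
The analytic input is `eventually_rpow_mul_exp_le` (`m^{(c+1)x} e^{−E} ≤ a` for `E ≥ m^γ/C`, `x ≤ m^{γ−η}`) and the two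
exponent estimates of `…ColumnSpaceHalf.eventually_catch_exponent_linear_var`, re-derived here with the polynomial factor
`m^c` replaced by `m^{(c+1)x}`. [new]
-/

set_option linter.dupNamespace false

namespace Summit.PneNP.PneNP.Theorems

open Finset Real Filter Literature.Computability.Complexity
open Summit.PneNP.PneNP.Cruxes.ConvexGateBlind.StrictRankConicCover (Edge cdist)

noncomputable section

/-! ## Stretched exponentials beat `m^{(c+1)·m^{γ−η}}` -/

/-- **Stretched exponentials beat slowly growing powers, uniformly.** For `0 < η < γ`, `C, a > 0` and `c : ℕ`: eventually in
`m`, every `E ≥ m^γ/C` and every `0 ≤ x ≤ m^{γ−η}` satisfy `m^{(c+1)x} · e^{−E} ≤ a`. [folklore] -/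
theorem eventually_rpow_mul_exp_le {γ η C a : ℝ} (hη : 0 < η) (hηγ : η < γ) (hC : 0 < C) (ha : 0 < a) (c : ℕ) :
    ∀ᶠ m : ℕ in atTop, ∀ E : ℝ, (m : ℝ) ^ γ / C ≤ E → ∀ x : ℝ, 0 ≤ x → x ≤ (m : ℝ) ^ (γ - η) →
      (m : ℝ) ^ (((c : ℝ) + 1) * x) * Real.exp (-E) ≤ a := by
  -- `log m ≤ m^η / (2C(c+1))` and `|log a| ≤ m^η/(2C)` eventually
  have hlog : ∀ᶠ m : ℕ in atTop, ((c : ℝ) + 1) * Real.log m ≤ (m : ℝ) ^ η / (2 * C) := by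
    have ho := (isLittleO_log_rpow_atTop hη).def (show (0 : ℝ) < 1 / (2 * C * ((c : ℝ) + 1)) by positivity)
    have ho' := tendsto_natCast_atTop_atTop.eventually ho
    filter_upwards [ho', eventually_ge_atTop 1] with m hm hm1
    have hm1R : (1 : ℝ) ≤ m := by exact_mod_cast hm1
    rw [Real.norm_of_nonneg (Real.log_nonneg hm1R), Real.norm_of_nonneg (by positivity)] at hm
    have hc0 : (0 : ℝ) < (c : ℝ) + 1 := by positivity
    calc ((c : ℝ) + 1) * Real.log m ≤ ((c : ℝ) + 1) * (1 / (2 * C * ((c : ℝ) + 1)) * (m : ℝ) ^ η) :=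
          mul_le_mul_of_nonneg_left hm hc0.le
      _ = (m : ℝ) ^ η / (2 * C) := by field_simp
  have hconst : ∀ᶠ m : ℕ in atTop, |Real.log a| ≤ (m : ℝ) ^ η / (2 * C) := by
    have ht : Tendsto (fun m : ℕ => (m : ℝ) ^ η / (2 * C)) atTop atTop :=
      ((tendsto_rpow_atTop hη).comp tendsto_natCast_atTop_atTop).atTop_div_const (by positivity)
    exact ht.eventually_ge_atTop _
  filter_upwards [hlog, hconst, eventually_ge_atTop 1] with m hlogm hconstm hm1
  intro E hE x hx0 hx
  have hm1R : (1 : ℝ) ≤ m := by exact_mod_cast hm1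
  have hm0 : (0 : ℝ) < m := by linarith
  have hlog0 : 0 ≤ Real.log m := Real.log_nonneg hm1R
  have hγη : 0 ≤ γ - η := by linarith
  -- `m^{(c+1)x} = exp((c+1) x log m) ≤ exp((c+1) m^{γ-η} log m)`
  have hpow : (m : ℝ) ^ (((c : ℝ) + 1) * x) = Real.exp (((c : ℝ) + 1) * x * Real.log m) := by
    rw [Real.rpow_def_of_pos hm0]; ring_nf
  rw [hpow, ← Real.exp_add]
  have hone : (1 : ℝ) ≤ (m : ℝ) ^ (γ - η) := Real.one_le_rpow hm1R hγη
  have hsplit : (m : ℝ) ^ γ = (m : ℝ) ^ (γ - η) * (m : ℝ) ^ η := by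
    rw [← Real.rpow_add hm0]; ring_nf
  -- the exponent is `≤ log a`
  have hexp : ((c : ℝ) + 1) * x * Real.log m + -E ≤ Real.log a := by
    have h1 : ((c : ℝ) + 1) * x * Real.log m ≤ (m : ℝ) ^ (γ - η) * (((c : ℝ) + 1) * Real.log m) := by
      have := mul_le_mul_of_nonneg_right hx (mul_nonneg (by positivity : (0 : ℝ) ≤ (c : ℝ) + 1) hlog0)
      nlinarith [this]
    have h2 : (m : ℝ) ^ (γ - η) * (((c : ℝ) + 1) * Real.log m) ≤ (m : ℝ) ^ (γ - η) * ((m : ℝ) ^ η / (2 * C)) :=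
      mul_le_mul_of_nonneg_left hlogm (by positivity)
    have h3 : -Real.log a ≤ (m : ℝ) ^ (γ - η) * ((m : ℝ) ^ η / (2 * C)) := by
      calc -Real.log a ≤ |Real.log a| := neg_le_abs _
        _ ≤ (m : ℝ) ^ η / (2 * C) := hconstm
        _ = 1 * ((m : ℝ) ^ η / (2 * C)) := (one_mul _).symm
        _ ≤ (m : ℝ) ^ (γ - η) * ((m : ℝ) ^ η / (2 * C)) := mul_le_mul_of_nonneg_right hone (by positivity)
    have h4 : (m : ℝ) ^ (γ - η) * ((m : ℝ) ^ η / (2 * C)) + (m : ℝ) ^ (γ - η) * ((m : ℝ) ^ η / (2 * C)) =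
        (m : ℝ) ^ γ / C := by rw [hsplit]; field_simp; ring
    have h5 : (m : ℝ) ^ γ / C ≤ E := hE
    linarith
  calc Real.exp (((c : ℝ) + 1) * x * Real.log m + -E) ≤ Real.exp (Real.log a) := Real.exp_le_exp.2 hexp
    _ = a := Real.exp_log ha

/-! ## The two exponent estimates (as in `eventually_catch_exponent_linear_var`) -/

/-- **First exponent.** For reals `400 ≤ k`, `2k² ≤ m`, `k ≤ 2m^δ`: `m^{1−2δ}/2³³ ≤ (k−1)(m−1)/(2304·k·(400k−1)²)`. [new] -/
theorem catch_exponent_one_ge {k m δ : ℝ} (hK4 : 400 ≤ k) (hsq : 2 * k ^ 2 ≤ m) (hK2 : k ≤ 2 * m ^ δ) :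
    m ^ (1 - 2 * δ) / 2 ^ 33 ≤ (k - 1) * (m - 1) / (2304 * k * (400 * k - 1) ^ 2) := by
  have hm0 : 0 < m := by nlinarith
  set L : ℝ := 400 * k - 1 with hL
  have hL0 : 0 < L := by rw [hL]; linarith
  have hLle : L ≤ 400 * k := by rw [hL]; linarith
  have hK2δ : k ^ 2 ≤ 2 ^ 2 * m ^ (2 * δ) := by
    calc k ^ 2 ≤ (2 * m ^ δ) ^ 2 := pow_le_pow_left₀ (by linarith) hK2 2
      _ = 2 ^ 2 * (m ^ δ) ^ 2 := by rw [mul_pow]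
      _ = 2 ^ 2 * m ^ (2 * δ) := by
          have e3 : δ * ((2 : ℕ) : ℝ) = 2 * δ := by push_cast; ring
          rw [← Real.rpow_natCast (m ^ δ) 2, ← Real.rpow_mul hm0.le, e3]
  have hden : 0 < 2304 * k * L ^ 2 := by positivity
  rw [div_le_div_iff₀ (by positivity) hden]
  have hL2 : L ^ 2 ≤ 160000 * k ^ 2 := by
    calc L ^ 2 ≤ (400 * k) ^ 2 := pow_le_pow_left₀ hL0.le hLle 2
      _ = 160000 * k ^ 2 := by ring
  have hprod : m ^ (1 - 2 * δ) * m ^ (2 * δ) = m := by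
    rw [← Real.rpow_add hm0]
    have : (1 - 2 * δ + 2 * δ : ℝ) = 1 := by ring
    rw [this, Real.rpow_one]
  have hmγ0 : 0 ≤ m ^ (1 - 2 * δ) := by positivity
  have hk0 : 0 ≤ k := by linarith
  calc m ^ (1 - 2 * δ) * (2304 * k * L ^ 2) = 2304 * k * (m ^ (1 - 2 * δ) * L ^ 2) := by ring
    _ ≤ 2304 * k * (m ^ (1 - 2 * δ) * (160000 * (2 ^ 2 * m ^ (2 * δ)))) := by
        refine mul_le_mul_of_nonneg_left (mul_le_mul_of_nonneg_left (hL2.trans (by linarith)) hmγ0) (by positivity)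
    _ = 2304 * 640000 * k * (m ^ (1 - 2 * δ) * m ^ (2 * δ)) := by ring
    _ = 2304 * 640000 * k * m := by rw [hprod]
    _ ≤ (k - 1) * (m - 1) * 2 ^ 33 := by
        have hk1 : k / 2 ≤ k - 1 := by linarith
        have hm1' : m / 2 ≤ m - 1 := by nlinarith
        have hprod2 := mul_le_mul hk1 hm1' (by positivity) (by linarith)
        have hkm0 : (0 : ℝ) ≤ k * m := by positivity
        nlinarith [hprod2, hkm0]

/-- **Second exponent.** For reals `400 ≤ k`, `400k ≤ m`, `2k² ≤ m`, `k ≤ 2m^δ`: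
`m^{(1−2δ)/2}/2¹⁵ ≤ 1/(5200·√(2k(k−2)/(m−k−1)))`. [new] -/
theorem catch_exponent_two_ge {k m δ : ℝ} (hK4 : 400 ≤ k) (hKm : 400 * k ≤ m) (hsq : 2 * k ^ 2 ≤ m)
    (hK2 : k ≤ 2 * m ^ δ) :
    m ^ ((1 - 2 * δ) / 2) / 2 ^ 15 ≤ 1 / (5200 * Real.sqrt (2 * k * (k - 2) / (m - k - 1))) := by
  have hm0 : 0 < m := by nlinarith
  set γ₂ : ℝ := (1 - 2 * δ) / 2 with hγ₂
  set β : ℝ := 2 * k * (k - 2) / (m - k - 1) with hβ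
  have hmk : (0 : ℝ) < m - k - 1 := by nlinarith
  have hβ0 : 0 < β := by rw [hβ]; exact div_pos (by nlinarith) hmk
  have hβle : β ≤ 4 * k ^ 2 / m := by
    rw [hβ, div_le_div_iff₀ hmk hm0]
    have hk0 : (0 : ℝ) ≤ k := by linarith
    have h1 : 2 * k ^ 2 * k ^ 2 ≤ m * k ^ 2 := mul_le_mul_of_nonneg_right hsq (sq_nonneg _)
    nlinarith [h1, hk0]
  have hK2δ : k ^ 2 ≤ 2 ^ 2 * m ^ (2 * δ) := by
    calc k ^ 2 ≤ (2 * m ^ δ) ^ 2 := pow_le_pow_left₀ (by linarith) hK2 2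
      _ = 2 ^ 2 * (m ^ δ) ^ 2 := by rw [mul_pow]
      _ = 2 ^ 2 * m ^ (2 * δ) := by
          have e3 : δ * ((2 : ℕ) : ℝ) = 2 * δ := by push_cast; ring
          rw [← Real.rpow_natCast (m ^ δ) 2, ← Real.rpow_mul hm0.le, e3]
  set D₂ : ℝ := 5200 * Real.sqrt β with hD₂
  have hsqβ : 0 < Real.sqrt β := Real.sqrt_pos.2 hβ0
  have hD₂0 : 0 < D₂ := by rw [hD₂]; positivity
  have hD₂sq : D₂ ^ 2 ≤ (2 ^ 15 * m ^ (-γ₂)) ^ 2 := by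
    have hsq' : D₂ ^ 2 = 5200 ^ 2 * β := by rw [hD₂, mul_pow, Real.sq_sqrt hβ0.le]
    have hrhs : (2 ^ 15 * m ^ (-γ₂)) ^ 2 = 2 ^ 30 * m ^ (2 * δ - 1) := by
      have e1 : ((2 : ℝ) ^ 15) ^ 2 = 2 ^ 30 := by norm_num
      have e2 : -γ₂ * ((2 : ℕ) : ℝ) = 2 * δ - 1 := by rw [hγ₂]; push_cast; ring
      rw [mul_pow, ← Real.rpow_natCast (m ^ (-γ₂)) 2, ← Real.rpow_mul hm0.le, e1, e2]
    rw [hsq', hrhs]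
    calc (5200 : ℝ) ^ 2 * β ≤ 5200 ^ 2 * (4 * k ^ 2 / m) := mul_le_mul_of_nonneg_left hβle (by positivity)
      _ ≤ 5200 ^ 2 * (4 * (2 ^ 2 * m ^ (2 * δ)) / m) := by gcongr
      _ = 5200 ^ 2 * 16 * m ^ (2 * δ - 1) := by
          rw [Real.rpow_sub_one hm0.ne']
          ring
      _ ≤ 2 ^ 30 * m ^ (2 * δ - 1) := by
          have : (0 : ℝ) ≤ m ^ (2 * δ - 1) := by positivity
          nlinarith
  have hD₂le : D₂ ≤ 2 ^ 15 * m ^ (-γ₂) :=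
    (pow_le_pow_iff_left₀ hD₂0.le (by positivity) two_ne_zero).1 hD₂sq
  rw [div_le_div_iff₀ (by positivity) hD₂0]
  calc m ^ γ₂ * D₂ ≤ m ^ γ₂ * (2 ^ 15 * m ^ (-γ₂)) := mul_le_mul_of_nonneg_left hD₂le (by positivity)
    _ = 1 * 2 ^ 15 := by
        rw [Real.rpow_neg hm0.le, mul_comm (2 ^ 15 : ℝ), ← mul_assoc,
          mul_inv_cancel₀ (Real.rpow_pos_of_pos hm0 γ₂).ne']

/-! ## The catch exponent against `m^{(c+1)x}`, `x ≤ m^{(1−2δ)/2 − η}` -/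

/-- **The third-generation catch exponent beats `m^{(c+1)x}` for `x ≤ m^{(1−2δ)/2−η}`.** With `k = ⌈m^δ⌉₊`, `L = 400k−1`,
`β' = 2k(k−2)/(m−k−1)`: for `0 < η < (1−2δ)/2`, eventually `400 ≤ k`, `400k ≤ m`, `2k² ≤ m` and
`m^{(c+1)x} · (exp(−(k−1)(m−1)/(2304kL²)) + exp(−1/(5200√β'))) ≤ 1/4` for all `0 ≤ x ≤ m^{(1−2δ)/2−η}`. [new] -/
theorem eventually_catch_exponent_codim {δ η : ℝ} (hδ0 : 0 < δ) (hη0 : 0 < η) (hη1 : η < (1 - 2 * δ) / 2)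
    (c : ℕ) :
    ∀ᶠ m : ℕ in atTop, 400 ≤ ⌈(m : ℝ) ^ δ⌉₊ ∧ 400 * ⌈(m : ℝ) ^ δ⌉₊ ≤ m ∧ 2 * ⌈(m : ℝ) ^ δ⌉₊ ^ 2 ≤ m ∧
      ∀ x : ℝ, 0 ≤ x → x ≤ (m : ℝ) ^ ((1 - 2 * δ) / 2 - η) →
      (m : ℝ) ^ (((c : ℝ) + 1) * x) * (Real.exp (-((((⌈(m : ℝ) ^ δ⌉₊ : ℝ)) - 1) * ((m : ℝ) - 1) /
          (2304 * ⌈(m : ℝ) ^ δ⌉₊ * (400 * (⌈(m : ℝ) ^ δ⌉₊ : ℝ) - 1) ^ 2))) +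
        Real.exp (-(1 / (5200 * Real.sqrt (2 * ((⌈(m : ℝ) ^ δ⌉₊ : ℝ)) * (((⌈(m : ℝ) ^ δ⌉₊ : ℝ)) - 2) /
          ((m : ℝ) - ⌈(m : ℝ) ^ δ⌉₊ - 1)))))) ≤ 1 / 4 := by
  have hγ₁0 : 0 < 1 - 2 * δ := by linarith
  have hη₁ : 0 < (1 - 2 * δ) / 2 + η := by linarith
  have hη₁' : (1 - 2 * δ) / 2 + η < 1 - 2 * δ := by linarith
  filter_upwards [eventually_ceil_rpow_ge_and_mul_le hδ0 (by linarith) 400,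
    eventually_two_mul_ceil_rpow_sq_le hδ0 (by linarith),
    eventually_rpow_mul_exp_le hη₁ hη₁' (by norm_num : (0 : ℝ) < 2 ^ 33) (by norm_num : (0 : ℝ) < 1 / 8) c,
    eventually_rpow_mul_exp_le hη0 hη1 (by norm_num : (0 : ℝ) < 2 ^ 15) (by norm_num : (0 : ℝ) < 1 / 8) c,
    eventually_ge_atTop 2] with m hm4 hsq hE1 hE2 hm2
  obtain ⟨hk4, hkm⟩ := hm4
  refine ⟨hk4, hkm, hsq, ?_⟩
  intro x hx0 hx
  have hx₁ : x ≤ (m : ℝ) ^ (1 - 2 * δ - ((1 - 2 * δ) / 2 + η)) := by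
    have : 1 - 2 * δ - ((1 - 2 * δ) / 2 + η) = (1 - 2 * δ) / 2 - η := by ring
    rw [this]; exact hx
  set k : ℕ := ⌈(m : ℝ) ^ δ⌉₊ with hk
  have hK4 : (400 : ℝ) ≤ k := by exact_mod_cast hk4
  have hKm : 400 * (k : ℝ) ≤ m := by exact_mod_cast hkm
  have hsqR : 2 * (k : ℝ) ^ 2 ≤ m := by exact_mod_cast hsq
  have hm2R : (2 : ℝ) ≤ m := by exact_mod_cast hm2
  have hK2 : (k : ℝ) ≤ 2 * (m : ℝ) ^ δ := by
    have hxge1 : (1 : ℝ) ≤ (m : ℝ) ^ δ := Real.one_le_rpow (by linarith) hδ0.le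
    have := Nat.ceil_lt_add_one (by positivity : (0 : ℝ) ≤ (m : ℝ) ^ δ)
    rw [← hk] at this
    linarith
  have hT1 := hE1 _ (catch_exponent_one_ge hK4 hsqR hK2) x hx0 hx₁
  have hT2 := hE2 _ (catch_exponent_two_ge hK4 hKm hsqR hK2) x hx0 hx
  rw [mul_add]
  linarith

/-! ## The quantitative eventual forms -/

/-- **Quantitative codimension theorem.** For every `δ ∈ (0,1/2)`, every `0 < η < (1−2δ)/2` and every `c`: eventually in
`m` (`k = ⌈m^δ⌉₊`), for every `ε > 0`, every `R ≤ m^c` and every `p` with `p + 1 ≤ m^{(1−2δ)/2 − η}`, there is NO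
non-negative factorisation `cdist Q u − ε = ∑_{l<R} U_l(u) V_l(Q)` (all `k`-sets `Q`, all `k`-clique-free `u`) whose row
objects have codimension defect `≤ p` over the column space. Polynomial-size LP refutations need row objects spanning at
least `m^{1/2 − δ − o(1)}` directions outside `span{Q ↦ [e ⊆ Q]}`. [new] -/
theorem lpSlice_codim_gt_rpow {δ η : ℝ} (hδ0 : 0 < δ) (hη0 : 0 < η) (hη1 : η < (1 - 2 * δ) / 2) (c : ℕ) :
    ∀ᶠ m : ℕ in atTop, ∀ ε : ℝ, 0 < ε → ∀ R : ℕ, R ≤ m ^ c → ∀ p : ℕ, (p : ℝ) + 1 ≤ (m : ℝ) ^ ((1 - 2 * δ) / 2 - η) →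
      ∀ (U : (Edge m → Bool) → Fin R → ℝ) (V : Fin R → Finset (Fin m) → ℝ),
      (∀ u l, 0 ≤ U u l) → (∀ l (Q : Finset (Fin m)), Q.card = ⌈(m : ℝ) ^ δ⌉₊ → 0 ≤ V l Q) →
      (∀ s : Finset (Fin R), s.card = p + 1 → ∃ h : Fin R → ℝ, (∀ l, l ∉ s → h l = 0) ∧ h ≠ 0 ∧
        ∃ t : Edge m → ℝ, ∀ Q : Finset (Fin m), Q.card = ⌈(m : ℝ) ^ δ⌉₊ →
          ∑ l, h l * V l Q = ∑ e, (if cliqueVec Q e = true then t e else 0)) →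
      ¬ ∀ (Q : Finset (Fin m)) (u : Edge m → Bool), Q.card = ⌈(m : ℝ) ^ δ⌉₊ → cliqueFn m ⌈(m : ℝ) ^ δ⌉₊ u = false →
          cdist Q u - ε = ∑ l, U u l * V l Q := by
  filter_upwards [eventually_catch_exponent_codim hδ0 hη0 hη1 c, eventually_ge_atTop 2] with m hm hm2
  obtain ⟨hkB, hkm, hsq, hsmall⟩ := hm
  intro ε hε R hR p hp U V hU hV hP hall
  set k : ℕ := ⌈(m : ℝ) ^ δ⌉₊ with hk
  have hk4 : 4 ≤ k := by omega
  have hkm2 : k + 2 ≤ m := by nlinarith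
  have hkR : (4 : ℝ) ≤ k := by exact_mod_cast hk4
  have hL1 : (1 : ℝ) ≤ 400 * (k : ℝ) - 1 := by nlinarith
  have hLq : (k : ℝ) - 1 ≤ 12 * (400 * (k : ℝ) - 1) := by nlinarith
  set θ : ℝ := Real.exp (-(((k : ℝ) - 1) * ((m : ℝ) - 1) / (2304 * k * (400 * (k : ℝ) - 1) ^ 2))) +
    Real.exp (-(1 / (5200 * Real.sqrt (2 * (k : ℝ) * ((k : ℝ) - 2) / ((m : ℝ) - k - 1))))) with hθ
  have hlb := codim_terms_lower_bound_of_catch (by omega) hkm2 U V hU hV ε hε hall hP θ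
    (fun w hw => by
      have h := card_badColourings_le_var hk4 hsq (400 * (k : ℝ) - 1) hL1 hLq
        (fun v hv => abs_sum_le_linear hk4 (by omega) v hv) w hw
      rw [hθ, mul_add]
      exact h)
  have hθ0 : 0 < θ := by rw [hθ]; positivity
  have hq3 : (3 : ℝ) ≤ ((k - 1 : ℕ) : ℝ) := by
    have : 3 ≤ k - 1 := by omega
    exact_mod_cast this
  set qm : ℝ := ((k - 1 : ℕ) : ℝ) ^ m with hqm
  have hqm0 : 0 < qm := by rw [hqm]; positivity
  have hq_le : ((k - 1 : ℕ) : ℝ) ≤ qm / 2 := by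
    obtain ⟨m', hm'⟩ : ∃ m', m = m' + 2 := ⟨m - 2, by omega⟩
    rw [hqm, hm', pow_succ, pow_succ]
    have h1 : (1 : ℝ) ≤ ((k - 1 : ℕ) : ℝ) ^ m' := one_le_pow₀ (by linarith)
    have hQ0 : (0 : ℝ) ≤ ((k - 1 : ℕ) : ℝ) := by positivity
    have h2 := mul_le_mul h1 hq3 (by norm_num) (by positivity)
    have h3 := mul_le_mul_of_nonneg_right h2 hQ0
    linarith
  -- `(R+1)^{p+1} ≤ m^{(c+1)(p+1)}` as a real power
  have hm2R : (2 : ℝ) ≤ m := by exact_mod_cast hm2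
  have hm0 : (0 : ℝ) < m := by linarith
  have hRpow : ((R : ℝ) + 1) ^ (p + 1) ≤ (m : ℝ) ^ (((c : ℝ) + 1) * ((p : ℝ) + 1)) := by
    have hR' : (R : ℝ) ≤ (m : ℝ) ^ c := by exact_mod_cast hR
    have h1 : (R : ℝ) + 1 ≤ (m : ℝ) ^ (c + 1) := by
      have hmc : (1 : ℝ) ≤ (m : ℝ) ^ c := one_le_pow₀ (by linarith)
      calc (R : ℝ) + 1 ≤ (m : ℝ) ^ c + (m : ℝ) ^ c := by linarith
        _ = 2 * (m : ℝ) ^ c := by ring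
        _ ≤ (m : ℝ) * (m : ℝ) ^ c := mul_le_mul_of_nonneg_right hm2R (by positivity)
        _ = (m : ℝ) ^ (c + 1) := by ring
    calc ((R : ℝ) + 1) ^ (p + 1) ≤ ((m : ℝ) ^ (c + 1)) ^ (p + 1) := pow_le_pow_left₀ (by positivity) h1 _
      _ = (m : ℝ) ^ (((c : ℝ) + 1) * ((p : ℝ) + 1)) := by
          rw [← Real.rpow_natCast ((m : ℝ) ^ (c + 1)) (p + 1), ← Real.rpow_natCast (m : ℝ) (c + 1),
            ← Real.rpow_mul hm0.le]
          push_cast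
          ring_nf
  have hsmall' := hsmall ((p : ℝ) + 1) (by positivity) hp
  have hRθ : ((R : ℝ) + 1) ^ (p + 1) * (qm * θ) ≤ qm / 4 := by
    calc ((R : ℝ) + 1) ^ (p + 1) * (qm * θ) ≤ (m : ℝ) ^ (((c : ℝ) + 1) * ((p : ℝ) + 1)) * (qm * θ) :=
          mul_le_mul_of_nonneg_right hRpow (by positivity)
      _ = qm * ((m : ℝ) ^ (((c : ℝ) + 1) * ((p : ℝ) + 1)) * θ) := by ring
      _ ≤ qm * (1 / 4) := mul_le_mul_of_nonneg_left hsmall' hqm0.le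
      _ = qm / 4 := by ring
  linarith

/-- **ε-sensitivity costs `m^{1/2−δ−o(1)}` terms.** For every `δ ∈ (0, 1/2)` and `0 < η < (1−2δ)/2`: eventually in `m`
(`k = ⌈m^δ⌉₊`), for every `ε > 0`, every `p` with `p + 1 ≤ m^{(1−2δ)/2−η}` and every `R ≤ C(m,2) + p`, there is NO
non-negative factorisation `cdist Q u − ε = ∑_{l<R} U_l(u) V_l(Q)` (`U ≥ 0`, `V_l ≥ 0` on `k`-sets) valid for all `k`-sets
`Q` and all `k`-clique-free `u`: `rk₊(D − εJ) ≥ C(m,2) + m^{(1−2δ)/2−η}` for all `ε > 0`. [new] -/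
theorem lpSlice_terms_gt_choose_two_add_rpow {δ η : ℝ} (hδ0 : 0 < δ) (hδ1 : δ < 1 / 2) (hη0 : 0 < η)
    (hη1 : η < (1 - 2 * δ) / 2) :
    ∀ᶠ m : ℕ in atTop, ∀ ε : ℝ, 0 < ε → ∀ p : ℕ, (p : ℝ) + 1 ≤ (m : ℝ) ^ ((1 - 2 * δ) / 2 - η) →
      ∀ R : ℕ, R ≤ m.choose 2 + p →
      ∀ (U : (Edge m → Bool) → Fin R → ℝ) (V : Fin R → Finset (Fin m) → ℝ),
      (∀ u l, 0 ≤ U u l) → (∀ l (Q : Finset (Fin m)), Q.card = ⌈(m : ℝ) ^ δ⌉₊ → 0 ≤ V l Q) →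
      ¬ ∀ (Q : Finset (Fin m)) (u : Edge m → Bool), Q.card = ⌈(m : ℝ) ^ δ⌉₊ → cliqueFn m ⌈(m : ℝ) ^ δ⌉₊ u = false →
          cdist Q u - ε = ∑ l, U u l * V l Q := by
  filter_upwards [lpSlice_codim_gt_rpow hδ0 hη0 hη1 3, eventually_catch_exponent_linear_var hδ0 hδ1 0,
    eventually_ge_atTop 2] with m hcod hk hm2
  obtain ⟨hk4, hkm, -⟩ := hk
  intro ε hε p hp R hR U V hU hV hall
  have hkm2 : ⌈(m : ℝ) ^ δ⌉₊ + 2 ≤ m := by omega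
  -- `p ≤ m` (the exponent is `< 1`), hence `R ≤ m^3`
  have hm1R : (1 : ℝ) ≤ m := by exact_mod_cast (show 1 ≤ m by omega)
  have hpm : p ≤ m := by
    have h1 : (m : ℝ) ^ ((1 - 2 * δ) / 2 - η) ≤ (m : ℝ) ^ (1 : ℝ) :=
      Real.rpow_le_rpow_of_exponent_le hm1R (by linarith)
    rw [Real.rpow_one] at h1
    have : (p : ℝ) ≤ m := by linarith
    exact_mod_cast this
  have hR3 : R ≤ m ^ 3 := by
    have h1 : m.choose 2 ≤ m ^ 2 := Nat.choose_le_pow m 2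
    have h2 : m ^ 2 + m ≤ m ^ 3 := by
      have : m ^ 3 = m * m ^ 2 := by ring
      nlinarith
    omega
  exact hcod ε hε R hR3 p hp U V hU hV
    (fun s hs => exists_relation_of_card_le (by omega) hkm2 ε U V hall hR s hs) hall

/-- **Polynomial-size factorisations have factor rank `≥ C(m,2) + m^{(1−2δ)/2−η}`.** For `δ ∈ (0,1/2)`, `0 < η < (1−2δ)/2`
and every `c`: eventually in `m` (`k = ⌈m^δ⌉₊`), for every `ε > 0`, every `R ≤ m^c` and every `p` with
`p + 1 ≤ m^{(1−2δ)/2−η}`, there is NO non-negative factorisation `cdist Q u − ε = ∑_{l<R} U_l(u) V_l(Q)` whose row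
objects, restricted to `k`-sets, span at most `C(m,2) + p` dimensions: `rank(V) − rank(D − εJ) ≥ m^{1/2−δ−o(1)}` for
every polynomial-size NMF of the shifted clique-distance matrix. [new] -/
theorem lpSlice_factorRank_gt_rpow {δ η : ℝ} (hδ0 : 0 < δ) (hδ1 : δ < 1 / 2) (hη0 : 0 < η)
    (hη1 : η < (1 - 2 * δ) / 2) (c : ℕ) :
    ∀ᶠ m : ℕ in atTop, ∀ ε : ℝ, 0 < ε → ∀ R : ℕ, R ≤ m ^ c → ∀ p : ℕ, (p : ℝ) + 1 ≤ (m : ℝ) ^ ((1 - 2 * δ) / 2 - η) →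
      ∀ (U : (Edge m → Bool) → Fin R → ℝ) (V : Fin R → Finset (Fin m) → ℝ),
      (∀ u l, 0 ≤ U u l) → (∀ l (Q : Finset (Fin m)), Q.card = ⌈(m : ℝ) ^ δ⌉₊ → 0 ≤ V l Q) →
      Module.finrank ℝ (Submodule.span ℝ (Set.range fun l : Fin R =>
        fun Q : {Q : Finset (Fin m) // Q.card = ⌈(m : ℝ) ^ δ⌉₊} => V l Q.1)) ≤ m.choose 2 + p →
      ¬ ∀ (Q : Finset (Fin m)) (u : Edge m → Bool), Q.card = ⌈(m : ℝ) ^ δ⌉₊ → cliqueFn m ⌈(m : ℝ) ^ δ⌉₊ u = false →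
          cdist Q u - ε = ∑ l, U u l * V l Q := by
  filter_upwards [lpSlice_codim_gt_rpow hδ0 hη0 hη1 c, eventually_catch_exponent_linear_var hδ0 hδ1 0]
    with m hcod hk
  obtain ⟨hk4, hkm, -⟩ := hk
  intro ε hε R hR p hp U V hU hV hfr hall
  have hkm2 : ⌈(m : ℝ) ^ δ⌉₊ + 2 ≤ m := by omega
  exact hcod ε hε R hR p hp U V hU hV
    (fun s hs => exists_relation_of_finrank_le (by omega) hkm2 ε U V hall hfr s hs) hall

/-- **Quantitative codimension theorem** (registered form of `lpSlice_codim_gt_rpow`). [new] -/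
theorem lpSlice_codimension_rpow : ∀ (δ η : ℝ), 0 < δ → δ < 1 / 2 → 0 < η → η < (1 - 2 * δ) / 2 → ∀ c : ℕ, ∀ᶠ m : ℕ in Filter.atTop, ∀ ε : ℝ, 0 < ε → ∀ R : ℕ, R ≤ m ^ c → ∀ p : ℕ, (p : ℝ) + 1 ≤ (m : ℝ) ^ ((1 - 2 * δ) / 2 - η) → ∀ (U : (Edge m → Bool) → Fin R → ℝ) (V : Fin R → Finset (Fin m) → ℝ), (∀ u l, 0 ≤ U u l) → (∀ l (Q : Finset (Fin m)), Q.card = ⌈(m : ℝ) ^ δ⌉₊ → 0 ≤ V l Q) → (∀ s : Finset (Fin R), s.card = p + 1 → ∃ h : Fin R → ℝ, (∀ l, l ∉ s → h l = 0) ∧ h ≠ 0 ∧ ∃ t : Edge m → ℝ, ∀ Q : Finset (Fin m), Q.card = ⌈(m : ℝ) ^ δ⌉₊ → ∑ l, h l * V l Q = ∑ e, (if cliqueVec Q e = true then t e else 0)) → ¬ ∀ (Q : Finset (Fin m)) (u : Edge m → Bool), Q.card = ⌈(m : ℝ) ^ δ⌉₊ → cliqueFn m ⌈(m : ℝ) ^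 δ⌉₊ u = false → cdist Q u - ε = ∑ l, U u l * V l Q :=
  fun _ _ hδ0 _ hη0 hη1 c => lpSlice_codim_gt_rpow hδ0 hη0 hη1 c

/-- **Factor rank `≥ C(m,2) + m^{(1−2δ)/2−η}`** (registered form of `lpSlice_factorRank_gt_rpow`). [new] -/
theorem lpSlice_factor_rank_plus_rpow : ∀ (δ η : ℝ), 0 < δ → δ < 1 / 2 → 0 < η → η < (1 - 2 * δ) / 2 → ∀ c : ℕ, ∀ᶠ m : ℕ in Filter.atTop, ∀ ε : ℝ, 0 < ε → ∀ R : ℕ, R ≤ m ^ c → ∀ p : ℕ, (p : ℝ) + 1 ≤ (m : ℝ) ^ ((1 - 2 * δ) / 2 - η) → ∀ (U : (Edge m → Bool) → Fin R → ℝ) (V : Fin R → Finset (Fin m) → ℝ), (∀ u l, 0 ≤ U u l) → (∀ l (Q : Finset (Fin m)), Q.card = ⌈(m : ℝ) ^ δ⌉₊ → 0 ≤ V l Q) → Module.finrank ℝ (Submodule.span ℝ (Set.range fun l : Fin R => fun Q : {Q : Finset (Fin m) // Q.card = ⌈(m : ℝ) ^ δ⌉₊} => V l Q.1)) ≤ m.choose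 2 + p → ¬ ∀ (Q : Finset (Fin m)) (u : Edge m → Bool), Q.card = ⌈(m : ℝ) ^ δ⌉₊ → cliqueFn m ⌈(m : ℝ) ^ δ⌉₊ u = false → cdist Q u - ε = ∑ l, U u l * V l Q :=
  fun _ _ hδ0 hδ1 hη0 hη1 c => lpSlice_factorRank_gt_rpow hδ0 hδ1 hη0 hη1 c

/-- **ε-sensitivity costs `m^{1/2−δ−o(1)}` terms** (registered form of `lpSlice_terms_gt_choose_two_add_rpow`). [new] -/
theorem lpSlice_rank_plus_rpow : ∀ (δ η : ℝ), 0 < δ → δ < 1 / 2 → 0 < η → η < (1 - 2 * δ) / 2 → ∀ᶠ m : ℕ in Filter.atTop, ∀ ε : ℝ, 0 < ε → ∀ p : ℕ, (p : ℝ) + 1 ≤ (m : ℝ) ^ ((1 - 2 * δ) / 2 - η) → ∀ R : ℕ, R ≤ m.choose 2 + p → ∀ (U : (Edge m → Bool) → Fin R → ℝ) (V : Fin R → Finset (Fin m) → ℝ), (∀ u l, 0 ≤ U u l) → (∀ l (Q : Finset (Fin m)), Q.card = ⌈(m : ℝ) ^ δ⌉₊ → 0 ≤ V l Q) → ¬ ∀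 (Q : Finset (Fin m)) (u : Edge m → Bool), Q.card = ⌈(m : ℝ) ^ δ⌉₊ → cliqueFn m ⌈(m : ℝ) ^ δ⌉₊ u = false → cdist Q u - ε = ∑ l, U u l * V l Q :=
  fun _ _ hδ0 hδ1 hη0 hη1 => lpSlice_terms_gt_choose_two_add_rpow hδ0 hδ1 hη0 hη1

end

end Summit.PneNP.PneNP.Theorems
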